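import Literature.Analysis.FluidPDE.AcceleratedRelaxationEnhancingFlows
import Literature.Analysis.FunctionSpaces.TorusSobolevNorm
import Literature.Analysis.FunctionSpaces.HolderNorm
import HarnessLib

/-!
# Exponentially mixing flows with slow enhanced dissipation
# (Cooperman–Iyer–Rowan–Son 2025: Theorem 1.1, Proposition 2.2, Corollary 1.5)

W. Cooperman, G. Iyer, K. Rowan, S. Son, *Exponentially mixing flows with slow enhanced dissipation*,
arXiv:2507.21305 (v2, 30 Jul 2025, 29 pp.; page numbers below are those of the arXiv v2 PDF,
page-confirmed 2026-08-27). [`CoopermanIyerRowanSon2025`]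

Named facts (Literature is sorry-free, D-0014): `CoopermanIyerRowanSon2025_thm11` (Thm. 1.1: a
`κ`-uniformly bounded, `κ`-uniformly exponentially mixing family WITHOUT enhanced dissipation),
`CoopermanIyerRowanSon2025_prop22` (Prop. 2.2: velocity fields that are `O(κ)` in `W^{-1,∞}` do not
enhance dissipation), `CoopermanIyerRowanSon2025_cor15` (Cor. 1.5: a uniformly Lipschitz flow mixing
with rate `D(1+s^p)e^{-γt}` has dissipation time `O((log D)² + |log κ|²)`). Users take
`(h : CoopermanIyerRowanSon2025_thm11)` etc.

## Source (verbatim, arXiv v2)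

* Setting (p. 1): "Let `κ > 0`, `u = u^κ` be a (possibly time and `κ` dependent) divergence-free
  vector field on the `d`-dimensional torus, and let `θ^κ` solve the advection diffusion equation
  (1.1) `∂ₜθ^κ + u^κ·∇θ^κ - κΔθ^κ = 0`." Dissipation time (p. 1):
  "`t_dis(u,κ) := sup_{s ≥ 0} t^s_dis(u,κ)`, where for every `s ≥ 0`,
  `t^s_dis(u^κ,κ) := inf { t ≥ 0 | for every θ^κ_s ∈ L̇², we have ‖θ^κ_{s+t}‖_{L²} ≤ ‖θ^κ_s‖_{L²}/2 }`.
  Here the space `L̇² ⊆ L²(T^d)` is the space of mean-zero square integrable functions on the torus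
  `T^d`. Moreover, the function `θ^κ` in the infimum above is a solution to (1.1) with initial
  data `θ^κ_s`, specified at time `s`." (1.2) p. 2: "`t_dis(u^κ,κ) ≤ log 2/(λ₁κ)`, where `λ₁` is the
  smallest nonzero eigenvalue of the negative Laplacian."
* **Theorem 1.1** (p. 2): "For every sufficiently small `κ > 0`, there exists an incompressible
  velocity field `u^κ` (which will be constructed explicitly in Section 3, below) such that the
  following hold: (1) (Uniform `L^∞` boundedness) There exists constants `C, F` that are independent
  of `κ` such that for all `κ > 0`, `‖u^κ‖_{L^∞([0,∞)×T^d)} ≤ C` and `‖u^κ‖_{L^∞([0,∞);C¹(T^d))} < F/κ`,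
  (1.3) (2) (Exponential mixing) There exists constants `D, γ₁ > 0` (independent of `κ`) such that
  for all sufficiently small `κ > 0`, every solution to the transport equation `∂ₜϕ + u^κ·∇ϕ = 0`,
  (1.4) with initial data `ϕ₀ ∈ Ḣ¹` satisfies the mixing bound for all `n, m ∈ 2ℕ`,
  `‖ϕ_{m+n}‖_{H^{-1}} ≤ D(m² + 1) exp(-γ₁ n) ‖ϕ_m‖_{H¹}`. (1.5) (3) (No enhanced dissipation) For
  all sufficiently small `κ > 0`, and for all `s ≥ 0`, the dissipation time satisfies the lower bound
  `t^s_dis(u^κ,κ) ≥ C/κ`. (1.6)" Proof, Step 1 (p. 10): "`‖u^κ‖_{L^∞([0,∞)×T^d)} ≤ 3A‖φ‖_∞` and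
  `‖u^κ‖_{L^∞([0,∞),C¹(T^d))} ≤ 3AN_κ‖φ'‖_∞`", `N_κ = ⌈1/κ⌉` (p. 8); the construction (§2.1, p. 8):
  "We let the torus `T²` be the square `[0,2π]²` with opposite sides identified", (2.2) p. 9:
  alternating horizontal / vertical shears `A(∑_i φ_κ(x₂ - α_i^{2n})) e₁` on `t ∈ [2n,2n+1)`,
  `A(∑_i φ_κ(x₁ - α_i^{2n+1})) e₂` on `t ∈ [2n+1,2n+2)`, `φ_κ(x) = φ(N_κ x)`.
* Mixing rate (1.8) (p. 3): "Let `h : [0,∞)² → (0,∞)` be a function such that for every `s`, the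
  function `t ↦ h(s,t)` is decreasing and vanishes at infinity. We say the velocity field `u` is
  mixing with rate `h` if for every `s, t ≥ 0`, and every `ϕ_s ∈ Ḣ¹`, the solution to (1.4) with
  `u_κ = u` and initial data `ϕ_s` at time `s` satisfies the mixing bound
  `‖ϕ_{s+t}‖_{H^{-1}} ≤ h(s,t)‖ϕ_s‖_{H¹}`. (1.8)"
* **Corollary 1.5** (p. 5): "Suppose `u ∈ L^∞([0,∞); W^{1,∞}(T^d))` is an incompressible velocity
  field with mixing rate `h(s,t) ≤ D(1 + s^p)e^{-γt}` for some `p ∈ [0,∞)`. Then for all `κ > 0`,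
  `t⁰_dis(u,κ) ≤ 224(‖∇u‖_{L^∞_{t,x}} + 1)·(1 + 224(p/γ)⁴(‖∇u‖_{L^∞_{t,x}} + 1) + ((log D)² + |log κ|²)/γ²)`."
  (The proof is in §5, pp. 23–26, from Proposition 5.1 and Proposition 1.4.)
* **Proposition 2.2** (p. 9): "Suppose `u_κ` is a family of velocity fields such that there exists
  a `d×d` skew-symmetric matrix valued function `H_κ` such that `u^κ_t = ∇·H^κ_t` and
  `‖H_κ‖_{L^∞} ≤ C₀κ`, (2.5) for some constant `C₀`. Then for every `s ≥ 0` we have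
  `t^s_dis(u_κ,κ) ≥ C₁/κ`, where `C₁ = min{log(4/3)/2, 1/(8C₀²)}`. (2.6)" Proof (§4, p. 22): energy
  estimate (4.2) for `w = θ^κ - φ^κ`, `φ^κ` the heat flow, datum "`e₁ = sin(x₁)`, the first
  eigenfunction of `-Δ` on `T^d` corresponding to the eigenvalue `λ₁ = 1`".

## Rendering (design choices; every deviation from print is a WEAKENING and is recorded here)

1. **Unit torus, existential constants.** The tree's torus is `T^d = UnitAddTorus d = ℝ^d/ℤ^d`
   (side `1`), the source's is `[0,2π]^d` (§2.1, and `λ₁ = 1`, `e₁ = sin x₁` in §4). The change of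
   variables `x = 2πy`, `t` unchanged, `u'(t,y) = u(t,2πy)/(2π)`, `κ' = κ/(4π²)` maps solutions of
   (1.1)/(1.4) on `[0,2π]^d` to solutions on the unit torus, preserves dissipation times, Lipschitz
   constants of the velocity (`∇_y u' = ∇_x u`), and the spectral `Ḣ^{±1}` mixing quotient
   (`Torus.eHomSobolevSeminorm (±1)` weighs the integer frequency `k` of `e^{2πik·y}` by `|k|^{±1}`),
   but NOT `κ` itself nor `sup|u|`; matrix-norm and metric conventions (`‖∇u‖_{L^∞}`, `‖H‖_{L^∞}`,
   the product metric of `UnitAddTorus d`) differ from any fixed reading of the source by factors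
   depending only on `d`. Therefore the explicit constants of the source (`224` in Cor. 1.5,
   `C₁ = min{log(4/3)/2, 1/(8C₀²)}` in Prop. 2.2) are transcribed EXISTENTIALLY (constants allowed
   to depend on `d`, and on `C₀` in Prop. 2.2), keeping the printed functional form: Cor. 1.5 becomes
   `t⁰_dis ≤ C₁(L+1)(1 + C₁(p/γ)⁴(L+1) + ((log D)² + (log κ)² + C₂)/γ²)` — under `D ↦ cD`,
   `κ ↦ κ/(4π²)` the printed bound turns into exactly this shape (`(log cD)² ≤ 2(log D)² + 2(log c)²`).
   Theorem 1.1's constants are existential in print already.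
2. **Dissipation time.** `‖Φ^{u,κ}_{s,s+t}‖_{L̇²→L̇²} ≤ 1/2` is the tree's `Rowan2024.HalvesNorm κ u s (s+t)`
   (every mean-zero `L²` datum released at time `s`, every weak solution with the time-shifted drift
   which is the `L²`-continuous representative, has `‖θ(t)‖² ≤ ¼‖θ_s‖²`; for `κ > 0` and a bounded
   drift the weak solution exists, is unique and `L²`-continuous, so this is the operator statement),
   so `t^s_dis(u,κ) = inf {t ≥ 0 : HalvesNorm κ u s (s+t)}` and the two printed inequalities are
   typed as exact `inf` statements, with no attainment claim: `CIRS2025.DissipationTimeGE κ u s τ`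
   (`t^s_dis ≥ τ`: no `t ∈ [0,τ)` halves) and `CIRS2025.DissipationTimeLE κ u s τ` (`t^s_dis ≤ τ`:
   for every `τ' > τ` some `t ∈ [0,τ']` halves).
3. **Mixing bounds.** "The solution of the transport equation (1.4) with datum `ϕ_s ∈ Ḣ¹` at time
   `s`" is rendered by the tree's weak (distributional, `L^∞_t L²_x`) solutions with `κ = 0`,
   `Torus.IsWeakScalarTransportOn T 0 (u(s+·)) ϕ_s ϕ` on `[0,T)`, `T > t`, which are the
   `L²`-continuous representative (`Torus.IsL2ContinuousOn`, so that time slices are genuine `L²`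
   functions); for the Lipschitz-in-space drifts of Thm. 1.1 and Cor. 1.5 these are unique
   (`Torus.IsWeakScalarTransportOn.unique_of_lipschitz`, DiPerna–Lions) and given by composition with
   the inverse flow, so "every weak solution" is "the solution". `Ḣ¹ =` mean-zero with
   `‖·‖_{Ḣ¹} < ∞`; real scalars enter `Torus.eHomSobolevSeminorm` through `(↑) : ℝ → ℂ` (the
   convention of `TorusSobolevNorm`). (1.5) is typed verbatim for solutions released at time `0`
   and even integer times `m, m+n` (`Even m`, `Even n`, `0` included, as in Step 2 p. 10:
   "for any `m,n ∈ 2ℕ`, `0 ≤ m ≤ n`"); (1.8) is `CIRS2025.MixingRateBound u h`.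
4. **Theorem 1.1.** `d = 2` (the construction of §2.1 is on `T²`). "Incompressible velocity field":
   space–time (a.e. strongly) measurable (`Torus.stLift`), weakly divergence free at every `t ≥ 0`
   (it is a shear). (1.3): the sup bound pointwise for `t ≥ 0` (the field (2.2) is an explicit
   bounded formula), and the `C¹` bound — computed in Step 1 p. 10 as the `W^{1,∞}` quantity
   `3AN_κ‖φ'‖_∞` — as `eBoundedHolderNorm 1 (u t) ≤ F/κ` (`sup|u(t)| + Lip(u(t))`, the norm used for
   `‖·‖_{C¹}` in `ElgindiLissMattingly2025.IsExponentialMixer`; `≤` for the printed `<`).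
   "Sufficiently small `κ`": `∃ κ₀ > 0, ∀ κ ∈ (0,κ₀)`.
5. **Proposition 2.2.** `H` is entrywise, `H : ℝ → T^d → d → d → ℝ`, skew (`H_{ji} = -H_{ij}`), with
   measurable entries and the ENTRYWISE bound `|H_{ij}| ≤ C₀κ` (it implies the operator-norm bound
   used in (4.2) up to a factor `d`, absorbed in the existential constant); `u = ∇·H` weakly at every
   `t ≥ 0`: `∫ ∑_j ∂_jφ H_{ij} = -∫ φ u_i` for smooth `φ` (`Torus.partialDeriv`; the index convention
   is immaterial since `H ↦ -H = Hᵀ` preserves the class). The velocity field is, in addition,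
   bounded, space–time measurable and weakly divergence free (the standing meaning of "velocity
   field" on p. 1, under which (1.1) is well posed in `L²`; a specialisation). The constant:
   `∀ C₀ > 0, ∃ c > 0` independent of `κ`, `u`, `s`.
6. **Corollary 1.5.** `u ∈ L^∞([0,∞);W^{1,∞}(T^d))`: bounded by some `M` and `L`-Lipschitz in space
   for every `t ≥ 0` (product metric of `UnitAddTorus d`), `L ≥ 0` any such constant (the printed
   bound is increasing in `‖∇u‖_{L^∞}`, so stating it for every upper bound `L` is equivalent);
   `D > 0`, `p ≥ 0` (`s^p = Real.rpow`, `0^0 = 1`), `γ > 0`; mixing rate EQUAL to `D(1+s^p)e^{-γt}`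
   (a rate `h ≤ D(1+s^p)e^{-γt}` is a fortiori this rate, (1.8) being an upper bound).
7. NOT typed: Problem 1.1 p. 4 (an OPEN PROBLEM — time-homogeneous exponential mixer in
   `L^∞_t C^{1,α}_x`; conjectures are not Literature), Remark 1.2 / (1.7), Proposition 1.3 (random
   dynamical systems under the assumptions of [CIS25]), Proposition 1.4 and Proposition 5.1 (the
   iteration step and the transport/advection–diffusion comparison with explicit constants `2^{15}`,
   `28`, `e³` — convention-bound as in 1.; Cor. 1.5 is their printed consequence), Lemma 2.1 (almost-sure
   mixing with a random prefactor), §1.4–1.5 heuristics ((1.11) is conjectural), §3 (Harris conditions).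

## References

* W. Cooperman, G. Iyer, K. Rowan, S. Son, arXiv:2507.21305v2: dissipation time p. 1; Thm. 1.1,
  Rmk. 1.2 p. 2; (1.8) p. 3; Problem 1.1, Prop. 1.3 p. 4; Prop. 1.4, Cor. 1.5 p. 5; §2.1 pp. 8–9;
  Lemma 2.1, Prop. 2.2, Def. 2.3 p. 9; proof of Thm. 1.1 p. 10; §4 p. 22; §5 pp. 23–26.
  [`CoopermanIyerRowanSon2025`]
* Y. Feng, G. Iyer, *Dissipation enhancement by mixing*, Nonlinearity 32 (2019) 1810–1851 (the
  `O(|log κ|²)` bound for uniformly `C¹` exponential mixers that Cor. 1.5 refines). [`FengIyer2019`]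
* K. Rowan, arXiv:2401.15001 = Nonlinearity 37 (2024) 095010, Def. 1.2–1.3 (the dissipation time;
  `Rowan2024.HalvesNorm`). [`Rowan2024`]
-/

open MeasureTheory Set Filter Topology Function Metric
open scoped ENNReal NNReal

namespace Literature.Analysis.FluidPDE

noncomputable section

open Literature.Analysis.FunctionSpaces Rowan2024

namespace CIRS2025

variable {d : Type*} [Fintype d]

/-! ## Dissipation-time inequalities (p. 1) over `Rowan2024.HalvesNorm` -/

/-- **`t^s_dis(u,κ) ≥ τ`** (p. 1): `t^s_dis(u,κ) = inf {t ≥ 0 : ‖Φ^{u,κ}_{s,s+t}‖_{L̇²→L̇²} ≤ 1/2}`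
is at least `τ`, i.e. NO `t ∈ [0,τ)` has `‖Φ^{u,κ}_{s,s+t}‖ ≤ 1/2` (`Rowan2024.HalvesNorm κ u s (s+t)`);
an exact rendering of the infimum inequality (module docstring, *Rendering* 2.).
[cite: CoopermanIyerRowanSon2025, §1.1 p. 1 (definition of t^s_dis)] -/
def DissipationTimeGE (κ : ℝ) (u : ℝ → UnitAddTorus d → EuclideanSpace ℝ d) (s τ : ℝ) : Prop :=
  ∀ t : ℝ, 0 ≤ t → t < τ → ¬ HalvesNorm κ u s (s + t)

/-- **`t^s_dis(u,κ) ≤ τ`** (p. 1): the infimum `t^s_dis(u,κ) = inf {t ≥ 0 : ‖Φ^{u,κ}_{s,s+t}‖ ≤ 1/2}`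
is at most `τ`, i.e. for every `τ' > τ` SOME `t ∈ [0,τ']` has `‖Φ^{u,κ}_{s,s+t}‖ ≤ 1/2`
(`Rowan2024.HalvesNorm κ u s (s+t)`); exact rendering, no attainment claimed (module docstring,
*Rendering* 2.). [cite: CoopermanIyerRowanSon2025, §1.1 p. 1 (definition of t^s_dis)] -/
def DissipationTimeLE (κ : ℝ) (u : ℝ → UnitAddTorus d → EuclideanSpace ℝ d) (s τ : ℝ) : Prop :=
  ∀ τ' : ℝ, τ < τ' → ∃ t : ℝ, 0 ≤ t ∧ t ≤ τ' ∧ HalvesNorm κ u s (s + t)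

/-! ## Mixing rates (1.8) -/

/-- **The mixing bound (1.8) at one pair of times `(s,t)` with constant `r = h(s,t)`**: for every
`ϕ_s ∈ Ḣ¹(T^d)` (mean-zero, `L²`, `‖ϕ_s‖_{Ḣ¹} < ∞`) the solution of the transport equation
`∂_τϕ + u·∇ϕ = 0` released at time `s` from `ϕ_s` satisfies `‖ϕ_{s+t}‖_{Ḣ⁻¹} ≤ r‖ϕ_s‖_{Ḣ¹}` —
rendered (module docstring, *Rendering* 3.): every weak solution `ϕ` of the transport equation with
the time-shifted drift `u(s+·)` and datum `ϕ_s` on `T^d × [0,T)`, `T > t`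
(`Torus.IsWeakScalarTransportOn T 0 (u(s+·)) ϕ_s ϕ`), which is the `L²`-continuous representative on
`[0,T)`, obeys the inequality at time `t`, the seminorms being `Torus.eHomSobolevSeminorm (∓1)` of the
complexified scalars. [cite: CoopermanIyerRowanSon2025, §1.2 (1.8) p. 3] -/
def MixingBoundAt (u : ℝ → UnitAddTorus d → EuclideanSpace ℝ d) (s t r : ℝ) : Prop :=
  ∀ ϕs : UnitAddTorus d → ℝ, MemLp ϕs 2 volume → ∫ x, ϕs x = 0 →
    Torus.eHomSobolevSeminorm 1 (fun x => (ϕs x : ℂ)) < ∞ →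
    ∀ (T : ℝ) (ϕ : ℝ → UnitAddTorus d → ℝ), t < T →
      Torus.IsWeakScalarTransportOn T 0 (fun τ => u (s + τ)) ϕs ϕ →
      Torus.IsL2ContinuousOn (Ico 0 T) ϕ →
        Torus.eHomSobolevSeminorm (-1) (fun x => (ϕ t x : ℂ)) ≤
          ENNReal.ofReal r * Torus.eHomSobolevSeminorm 1 (fun x => (ϕs x : ℂ))

/-- **"`u` is mixing with rate `h`"** (1.8): the mixing bound with constant `h(s,t)` for all
`s, t ≥ 0` (the source's standing monotonicity / decay of `h(s,·)` is a property of the rate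
function, not used in the statements typed here). [cite: CoopermanIyerRowanSon2025, §1.2 (1.8) p. 3] -/
def MixingRateBound (u : ℝ → UnitAddTorus d → EuclideanSpace ℝ d) (h : ℝ → ℝ → ℝ) : Prop :=
  ∀ s t : ℝ, 0 ≤ s → 0 ≤ t → MixingBoundAt u s t (h s t)

/-! ## `W^{-1,∞}`-smallness (2.5) -/

/-- **Hypothesis (2.5) with bound `B`**: there is a skew-symmetric matrix field `H = (H_{ij})` on
`[0,∞) × T^d` with measurable entries, `|H_{ij}(t,x)| ≤ B` (entrywise; (2.5) has `B = C₀κ`), and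
`u(t) = ∇·H(t)` weakly for every `t ≥ 0`: `∫ ∑_j ∂_jφ · H_{ij}(t) = -∫ φ · u_i(t)` for every smooth
`φ : T^d → ℝ` and every `i` (module docstring, *Rendering* 5.).
[cite: CoopermanIyerRowanSon2025, Prop. 2.2 (2.5) p. 9] -/
def HasSmallSkewPotential [DecidableEq d] (B : ℝ) (u : ℝ → UnitAddTorus d → EuclideanSpace ℝ d) :
    Prop :=
  ∃ H : ℝ → UnitAddTorus d → d → d → ℝ,
    (∀ t : ℝ, 0 ≤ t → ∀ (x : UnitAddTorus d) (i j : d), H t x j i = -H t x i j) ∧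
    (∀ t : ℝ, 0 ≤ t → ∀ i j : d, Measurable fun x => H t x i j) ∧
    (∀ t : ℝ, 0 ≤ t → ∀ (x : UnitAddTorus d) (i j : d), |H t x i j| ≤ B) ∧
    ∀ t : ℝ, 0 ≤ t → ∀ i : d, ∀ φ : UnitAddTorus d → ℝ, Torus.IsSmooth φ →
      ∫ x, ∑ j, Torus.partialDeriv j φ x * H t x i j = -∫ x, φ x * u t x i

end CIRS2025

open CIRS2025

/-! ## Theorem 1.1 -/

/-- **Cooperman–Iyer–Rowan–Son 2025, Theorem 1.1 (exponentially mixing flows with slow enhanced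
dissipation)**, on the unit torus `𝕋²` (module docstring, *Rendering* 1., 3., 4.): there are
constants `C, F, D, γ₁, c > 0` and `κ₀ > 0` such that for every `κ ∈ (0,κ₀)` there is a velocity
field `u = u^κ` on `[0,∞) × 𝕋²` — space–time measurable, weakly divergence free at every `t ≥ 0` —
with: (1) `|u(t,x)| ≤ C` and `‖u(t)‖_{C¹} ≤ F/κ` (`sup + Lip`, `eBoundedHolderNorm 1`) for all
`t ≥ 0`; (2) for every `ϕ₀ ∈ Ḣ¹` and every weak solution `ϕ` of `∂ₜϕ + u·∇ϕ = 0`, `ϕ(0) = ϕ₀` on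
`[0,T)` which is the `L²`-continuous representative, `‖ϕ(m+n)‖_{Ḣ⁻¹} ≤ D(m²+1)e^{-γ₁n}‖ϕ(m)‖_{Ḣ¹}`
for all even naturals `m, n` with `m + n < T`; (3) for every `s ≥ 0`, `t^s_dis(u,κ) ≥ c/κ`
(`CIRS2025.DissipationTimeGE`): no enhanced dissipation, the heat bound (1.2) being saturated.
[cite: CoopermanIyerRowanSon2025, Thm. 1.1 p. 2 (construction §2.1 pp. 8–9, proof p. 10)] -/
def CoopermanIyerRowanSon2025_thm11 : Prop :=
  ∃ C F D γ₁ c : ℝ, 0 < C ∧ 0 < F ∧ 0 < D ∧ 0 < γ₁ ∧ 0 < c ∧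
    ∃ κ₀ : ℝ, 0 < κ₀ ∧ ∀ κ ∈ Ioo (0 : ℝ) κ₀,
      ∃ u : ℝ → UnitAddTorus (Fin 2) → EuclideanSpace ℝ (Fin 2),
        AEStronglyMeasurable (Torus.stLift u) volume ∧
        (∀ t : ℝ, 0 ≤ t → Torus.IsWeaklyDivFree (u t)) ∧
        (∀ t : ℝ, 0 ≤ t → ∀ x : UnitAddTorus (Fin 2), ‖u t x‖ ≤ C) ∧
        (∀ t : ℝ, 0 ≤ t → eBoundedHolderNorm 1 (u t) ≤ ENNReal.ofReal (F / κ)) ∧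
        (∀ ϕ₀ : UnitAddTorus (Fin 2) → ℝ, MemLp ϕ₀ 2 volume → ∫ x, ϕ₀ x = 0 →
          Torus.eHomSobolevSeminorm 1 (fun x => (ϕ₀ x : ℂ)) < ∞ →
          ∀ (T : ℝ) (ϕ : ℝ → UnitAddTorus (Fin 2) → ℝ), 0 < T →
            Torus.IsWeakScalarTransportOn T 0 u ϕ₀ ϕ → Torus.IsL2ContinuousOn (Ico 0 T) ϕ →
            ∀ m n : ℕ, Even m → Even n → ((m + n : ℕ) : ℝ) < T →
              Torus.eHomSobolevSeminorm (-1) (fun x => (ϕ ((m + n : ℕ) : ℝ) x : ℂ)) ≤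
                ENNReal.ofReal (D * ((m : ℝ) ^ 2 + 1) * Real.exp (-(γ₁ * n))) *
                  Torus.eHomSobolevSeminorm 1 (fun x => (ϕ (m : ℝ) x : ℂ))) ∧
        (∀ s : ℝ, 0 ≤ s → DissipationTimeGE κ u s (c / κ))

/-! ## Proposition 2.2 -/

section AnyDimension

variable {d : Type*} [Fintype d]

/-- **Cooperman–Iyer–Rowan–Son 2025, Proposition 2.2 (fields that are `O(κ)` in `W^{-1,∞}` do not
enhance dissipation)**, on the unit torus `T^d` (module docstring, *Rendering* 1., 2., 5.): for every
`C₀ > 0` there is `c > 0` (depending only on `C₀` and `d`; printed on `[0,2π]^d`: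
`C₁ = min{log(4/3)/2, 1/(8C₀²)}`) such that for every `κ > 0` and every bounded, space–time
measurable velocity field `u` on `[0,∞) × T^d`, weakly divergence free at every `t ≥ 0`, of the form
`u = ∇·H` with `H` skew-symmetric and `|H_{ij}| ≤ C₀κ` (`CIRS2025.HasSmallSkewPotential (C₀κ) u`),
one has `t^s_dis(u,κ) ≥ c/κ` for every `s ≥ 0`.
[cite: CoopermanIyerRowanSon2025, Prop. 2.2 p. 9 (proof §4 p. 22)] -/
def CoopermanIyerRowanSon2025_prop22 [DecidableEq d] : Prop :=
  ∀ C₀ : ℝ, 0 < C₀ → ∃ c : ℝ, 0 < c ∧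
    ∀ (κ : ℝ) (u : ℝ → UnitAddTorus d → EuclideanSpace ℝ d), 0 < κ →
      AEStronglyMeasurable (Torus.stLift u) volume →
      (∃ M : ℝ, ∀ t : ℝ, 0 ≤ t → ∀ x : UnitAddTorus d, ‖u t x‖ ≤ M) →
      (∀ t : ℝ, 0 ≤ t → Torus.IsWeaklyDivFree (u t)) →
      HasSmallSkewPotential (C₀ * κ) u →
        ∀ s : ℝ, 0 ≤ s → DissipationTimeGE κ u s (c / κ)

/-! ## Corollary 1.5 -/

/-- **Cooperman–Iyer–Rowan–Son 2025, Corollary 1.5 (dissipation time of time-inhomogeneously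
mixing Lipschitz flows)**, on the unit torus `T^d` with existential absolute constants (module
docstring, *Rendering* 1., 2., 3., 6.; printed on `[0,2π]^d` with `C₁ = 224`, `C₂ = 0`): there are
`C₁ > 0`, `C₂ ≥ 0` (depending only on `d`) such that for every space–time measurable velocity field
`u` on `[0,∞) × T^d` which is bounded, weakly divergence free and `L`-Lipschitz in space at every
`t ≥ 0` (`‖∇u‖_{L^∞_{t,x}} ≤ L`), mixing with rate `h(s,t) = D(1+s^p)e^{-γt}` (`D > 0`, `p ≥ 0`,
`γ > 0`; `CIRS2025.MixingRateBound`), and every `κ > 0`: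
`t⁰_dis(u,κ) ≤ C₁(L+1)(1 + C₁(p/γ)⁴(L+1) + ((log D)² + (log κ)² + C₂)/γ²)`
(`CIRS2025.DissipationTimeLE`). [cite: CoopermanIyerRowanSon2025, Cor. 1.5 p. 5 (proof §5 pp. 23–26)] -/
def CoopermanIyerRowanSon2025_cor15 : Prop :=
  ∃ C₁ C₂ : ℝ, 0 < C₁ ∧ 0 ≤ C₂ ∧
    ∀ (u : ℝ → UnitAddTorus d → EuclideanSpace ℝ d) (M L D p γ : ℝ),
      AEStronglyMeasurable (Torus.stLift u) volume →
      (∀ t : ℝ, 0 ≤ t → Torus.IsWeaklyDivFree (u t)) →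
      (∀ t : ℝ, 0 ≤ t → ∀ x : UnitAddTorus d, ‖u t x‖ ≤ M) →
      0 ≤ L → (∀ t : ℝ, 0 ≤ t → ∀ x y : UnitAddTorus d, ‖u t x - u t y‖ ≤ L * dist x y) →
      0 < D → 0 ≤ p → 0 < γ →
      MixingRateBound u (fun s t => D * (1 + s ^ p) * Real.exp (-(γ * t))) →
      ∀ κ : ℝ, 0 < κ →
        DissipationTimeLE κ u 0
          (C₁ * (L + 1) *
            (1 + C₁ * (p / γ) ^ 4 * (L + 1) + (Real.log D ^ 2 + Real.log κ ^ 2 + C₂) / γ ^ 2))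

end AnyDimension

end

end Literature.Analysis.FluidPDE
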